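import Summits.BirchSwinnertonDyer.BirchSwinnertonDyer.Theorems.TameQuarticManinParityCuspRegularFormsMemTameNeronLatticeOfFact
import HarnessLib

/-!
# Route `TameQuarticManinParity`, LINE 43 (bsd-idea-3 g12): LP42c `CuspRegularFormsMemTameNeronLatticeOfCells`
# (stmt-BirchSwinnertonDyer-24164) ⟸ LP42 (24100) ⟸ the named fact `exists_tameNeronFormsAt_latticeCriterion`, BY NAME
# (`--supports` 24164; the unconditional item stays OPEN as print debt)

Cell `pub/bsd-wall`, D-0145 line `route-BirchSwinnertonDyer-TeichmullerTwistDescent`, seat `bsd-line-ttd-p1` g15.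
BSD is NOT proved by this; nothing of record closes. THEOREMS ONLY; axioms `propext`, `Classical.choice`, `Quot.sound`.
-/

set_option autoImplicit false
-- D-0017: single-problem summit, so `Summit.BirchSwinnertonDyer.BirchSwinnertonDyer.…` repeats a namespace BY DESIGN.
set_option linter.dupNamespace false

namespace Summit.BirchSwinnertonDyer.BirchSwinnertonDyer.Theorems.TameQuarticManinParity

open Summit.BirchSwinnertonDyer.BirchSwinnertonDyer.Theses.TameQuarticManinParity
open Literature.NumberTheory.EllipticCurves.ModularForms

/-- **LP42 ⟹ LP42c** (24100 ⟹ 24164): the cell version is the print statement at `v₃(N) = 2`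
(`padicValNat_conductorNorm_eq_two_of_subTprime`). [cite: CesnaviciusNeururerSaha2023, Thm. 5.15, Thm. 6.12 (b)] -/
theorem cuspRegularFormsMemTameNeronLatticeOfCells_of_cuspRegularFormsMemTameNeronLattice :
    CuspRegularFormsMemTameNeronLattice → CuspRegularFormsMemTameNeronLatticeOfCells := by
  unfold CuspRegularFormsMemTameNeronLattice CuspRegularFormsMemTameNeronLatticeOfCells
  intro hLP W _ _ _ _hadd ht
  exact hLP (W.conductorNorm ℤ) (padicValNat_conductorNorm_eq_two_of_subTprime W ht)

/-- **LP42c from the named fact** `exists_tameNeronFormsAt_latticeCriterion` (ČNS Prop. 5.14 + Thm. 6.12).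
[cite: CesnaviciusNeururerSaha2023, Prop. 5.14 (p. 39); Thm. 6.12 (b) (p. 46)] -/
theorem cuspRegularFormsMemTameNeronLatticeOfCells_of_latticeCriterion (h : exists_tameNeronFormsAt_latticeCriterion) :
    CuspRegularFormsMemTameNeronLatticeOfCells :=
  cuspRegularFormsMemTameNeronLatticeOfCells_of_cuspRegularFormsMemTameNeronLattice
    (cuspRegularFormsMemTameNeronLattice_of_latticeCriterion h)

end Summit.BirchSwinnertonDyer.BirchSwinnertonDyer.Theorems.TameQuarticManinParity
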